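import Summits.BirchSwinnertonDyer.BirchSwinnertonDyer.Theorems.ManinLocalTwoThreeKummerCoverSubgroupTwo
import Summits.BirchSwinnertonDyer.BirchSwinnertonDyer.Theorems.ManinLocalTwoThreeKummerSqRootTwoAdicallyBounded
import Summits.BirchSwinnertonDyer.BirchSwinnertonDyer.Theorems.ManinLocalTwoThreeKummerSquareRootSigmaDictionary
import Summits.BirchSwinnertonDyer.BirchSwinnertonDyer.Theorems.ManinLocalTwoThreeKLineCongruenceOfBoundedK
import Summits.BirchSwinnertonDyer.BirchSwinnertonDyer.Theorems.ManinLocalTwoThreeManinOddOfReducibleOfCuspidalKummer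
import HarnessLib

/-!
# The ℓ = 2 UDC chain ASSEMBLED modulo ONE analytic witness law: (AN3₂) the glue «modular-form witness with stabiliser `Γ_V` + Unbounded Denominators
# ⟹ `Λ₁(f) ≠ Λ₀(f)`», hence **`2 ∣ c₀ ⟹ Λ₁(f) ≠ Λ₀(f)`** and **C2 ON THE LOCUS `{∞,0}_f ∈ Λ₀(f)` ⊇ {ROOT NUMBER −1} for curves with a rational
# `2`-torsion point**, modulo (AN2₂) ∧ CDT ∧ F★ ∧ F♮ ∧ CES
(route `ManinLocalTwoThree`, deciding crux C2 `ManinOddAtFour` stmt-BirchSwinnertonDyer-22967; cell bsd-f2-manin, prover p2 gen 19; LEAD-MEMO v35 §3 «v24 design,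
reducible branch»; the ℓ = 2 port of LEAD p1 g15's (AN3) `…UDCGlue` and of the C3 compositions `…UDCLineAtNine`; `--supports stmt-BirchSwinnertonDyer-22967`)

THE CHAIN (LEAD-MEMO v35 §3).  `D` lattice-optimal (`Λ_W = c·Λ₀(f)`), `T = (e, ·)` a rational `2`-torsion point, `a` its half-period (S6₂), `V = V_{a,η(2a)}`
the `σ`-square root (S3₂), `Ξ_T` the Kummer series, `G₂ = t_s·V(c·E_f)` the analytic germ of `√Ξ_T` (p2 g17):
`2 ∣ c` ⟹ (BI₂, p2 `kummerSqRoot_unique_twoAdicallyIntegral`) every normalised square root of `Ξ_T` is `2`-adically integral ⟹ (**AN2₂, the WITNESS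
LAW — the one hypothesis of this file, written INLINE as the binder `hWL`**, port of the ℓ = 3 B-line (HOLB)/(INVB)/(RATB)/(DICT)/(INT)/(QEXNB)) a
holomorphic `F : ℍ → ℂ` of some weight `k` with algebraic-integer `q`-expansion, exponential growth at every cusp, and `Γ₀(N)`-stabiliser EXACTLY the
period group `Γ_V` of `V` ⟹ (CDT = Unbounded Denominators with algebraic-integer coefficients, tree fact; unbundled by p2 g18's
`KLine.unboundedDenominatorsWeightAlgInt_of_CDT_algInt'`; `Γ_V` is a finite-index subgroup by p2's (NC₂-a′)) `F` is `Γ(M)`-invariant ⟹ `V` is periodic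
under `c{∞,γ∞}_f` for `γ ∈ Γ₀(N) ∩ Γ(M)` ⟹ (p2's (NC₂-glue) + LEAD's endgame) **`Λ₁(f) ≠ Λ₀(f)`** ⟹ on the locus `{∞,0}_f ∈ Λ₀(f)` (LEAD's
`periodLatticeGamma1_eq_of_modularSymbol_zero_mem_of_print`, mod F★, F♮, CES), in particular for ROOT NUMBER `−1`: CONTRADICTION, so `2 ∤ c`.
* §1 **`periodLatticeGamma1_ne_of_sqRootWitness`** — (AN3₂): ONE witness `(k, F)` for ONE half-period + `∀ k, UnboundedDenominatorsWeightAlgInt k` ⟹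
  `Λ₁(f) ≠ Λ₀(f)`; `…_of_CDT_algInt` (the UDW input discharged from the printed CDT fact).
* §2 **`periodLatticeGamma1_ne_of_two_dvd_of_sqRootWitnessLaw`** — AN2₂ ∧ CDT ⟹ (`4 ∣ N`, lattice-optimal, a rational `2`-torsion point, `2 ∣ c` ⟹
  `Λ₁(f) ≠ Λ₀(f)`): an even Manin constant would FORCE a non-trivial Shimura `2`-quotient;
* §3 **`not_two_dvd_maninConstant_of_modularSymbol_zero_mem_of_sqRootWitnessLaw_of_print`** and **`…_of_rootNumber_eq_neg_one_…`** — C2 on the locus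
  `{∞,0}_f ∈ Λ₀(f)`, resp. for root number `−1` at the conductor level, for curves with a rational `2`-torsion point, modulo AN2₂ ∧ CDT ∧ F★ ∧ F♮ ∧ CES.
HONEST FRAMING.  CONDITIONAL compositions: the witness law AN2₂ is NOT proved (it is the ℓ = 2 port of ~10 landed ℓ = 3 files: holomorphic extension of
`G₂·P(j)^e·Δ^k` across `φ⁻¹(E[2]∖O)`, growth at the cusps, minimal-model integrality, `q`-expansion on all of `ℍ`); CDT, F★, F♮, CES are printed statement-only
facts; the IRREDUCIBLE half of C2 (no rational `2`-torsion) is F♯'s business, and the locus `{∞,0}_f ∉ Λ₀(f)` (analytic rank `0`, even-order cuspidal point)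
is untouched.  C2, Manin's conjecture and BSD are NOT proved.  No definitions, no sorry.
[cite: CalegariDimitrovTang2025, Thm. 1.0.1 and Remarks 58–59] [cite: KurthLong2008, Prop. 18] [cite: Stevens1989, §2] [cite: Stevens1982, Thm. 1.3.1]
[cite: ConradEdixhovenStein2003, §6.1.2 and Thm. 1.1.3] [cite: AtkinLehner1970, Thm. 3]
-/

set_option autoImplicit false
-- lint-debt: the directory name repeats the summit name (sibling precedent `ManinLocalTwoThreeUDCGlue.lean`)
set_option linter.dupNamespace false

noncomputable section

open PowerSeries CongruenceSubgroup Complex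
open scoped MatrixGroups ModularForm Manifold PeriodPair
open WeierstrassCurve Literature.NumberTheory.EllipticCurves Literature.NumberTheory.EllipticCurves.ModularForms
open Summit.BirchSwinnertonDyer.Rank1Residual.ManinAdditive
open Summit.BirchSwinnertonDyer.Rank1Residual.ManinAdditive.CuspidalKummer
open Summit.BirchSwinnertonDyer.Rank1Residual.ManinAdditive.UDCKummerLineK
open Summit.BirchSwinnertonDyer.BirchSwinnertonDyer.Theorems.ManinLocalTwoThree.SigmaSquareRoot
open Summit.BirchSwinnertonDyer.BirchSwinnertonDyer.Theorems.ManinLocalTwoThree.SigmaHabitat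
open Summit.BirchSwinnertonDyer.BirchSwinnertonDyer.Theorems.ManinLocalTwoThree.UDCTwo
open Summit.BirchSwinnertonDyer.BirchSwinnertonDyer.Theorems.ManinLocalTwoThree.KummerSqRootBounded

namespace Summit.BirchSwinnertonDyer.BirchSwinnertonDyer.Theorems.ManinLocalTwoThree.UDCTwo

variable {W : WeierstrassCurve ℚ} {N : ℕ} [NeZero N]

/-! ## §1 (AN3₂): a modular-form witness with stabiliser `Γ_V` + Unbounded Denominators ⟹ `Λ₁(f) ≠ Λ₀(f)` -/

/-- **(AN3₂) the ℓ = 2 UDC glue.**  `D` lattice-optimal, `a ∉ Λ` with `2a = m₁ω₁ + m₂ω₂`, `V = V_{a, m₁η₁+m₂η₂}`.  If some holomorphic `F : ℍ → ℂ` of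
weight `k` with algebraic-integer `q`-expansion and exponential growth at every cusp has `F ∣[k] γ = F ⟺ (V periodic under c{∞,γ∞}_f)` for `γ ∈ Γ₀(N)`,
then Unbounded Denominators (all weights, algebraic-integer coefficients) forces `Λ₁(f) ≠ Λ₀(f)`: `Γ_V` is a finite-index subgroup (NC₂-a′), so `F` is
`Γ(M)`-invariant, so `V` is periodic along `Γ₀(N) ∩ Γ(M)`, so along `Γ₁(N)` (NC₂-glue), contradicting S3b₂ on `Λ_W = cΛ₀ = cΛ₁` (LEAD's endgame).
CONDITIONAL on `hUDW`. [cite: CalegariDimitrovTang2025, Thm. 1.0.1] [cite: KurthLong2008, Prop. 18] -/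
theorem periodLatticeGamma1_ne_of_sqRootWitness [W.IsElliptic] [W.IsGloballyMinimal] (hUDW : ∀ k : ℤ, UnboundedDenominatorsWeightAlgInt k)
    (D : ModularParametrizationData W N) (hopt : ∀ z ∈ D.L.lattice, ∃ w ∈ periodLattice D.f, z = D.c * w)
    {a : ℂ} {m₁ m₂ : ℤ} (ha : a ∉ D.L.lattice) (h2a : 2 * a = m₁ * D.L.ω₁ + m₂ * D.L.ω₂) (k : ℤ) (F : UpperHalfPlane → ℂ)
    (hhol : MDifferentiable 𝓘(ℂ) 𝓘(ℂ) F)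
    (hinv : ∀ γ : Gamma0 N, (∀ w : ℂ, sigmaSqRoot D.L a (m₁ * D.L.η₁ + m₂ * D.L.η₂) (w + (D.c : ℂ) * cuspSymbol D.f γ) =
      sigmaSqRoot D.L a (m₁ * D.L.η₁ + m₂ * D.L.η₂) w) → F ∣[k] (γ : SL(2, ℤ)) = F)
    (hstab : ∀ γ : Gamma0 N, F ∣[k] (γ : SL(2, ℤ)) = F → ∀ w : ℂ,
      sigmaSqRoot D.L a (m₁ * D.L.η₁ + m₂ * D.L.η₂) (w + (D.c : ℂ) * cuspSymbol D.f γ) = sigmaSqRoot D.L a (m₁ * D.L.η₁ + m₂ * D.L.η₂) w)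
    (hgrowth : ∀ g : SL(2, ℤ), ∃ C A m : ℝ, ∀ τ : UpperHalfPlane, A ≤ τ.im → ‖(F ∣[k] g) τ‖ ≤ C * Real.exp (m * τ.im))
    (hq : ∃ b : ℕ → ℂ, (∀ n, IsIntegral ℤ (b n)) ∧ ∀ τ : UpperHalfPlane,
      HasSum (fun n : ℕ ↦ b n * Complex.exp (2 * Real.pi * Complex.I * (τ : ℂ) * n)) (F τ)) :
    periodLatticeGamma1 D.f ≠ periodLattice D.f := by
  obtain ⟨Γ, hmem, hle, hfi, -, -⟩ := exists_sigmaSqRootPeriodSubgroup D hopt ha h2a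
  have hΓinv : ∀ γ ∈ Γ, F ∣[k] γ = F := by
    intro γ hγ
    have hγ0 : γ ∈ Gamma0 N := hle hγ
    exact hinv ⟨γ, hγ0⟩ ((hmem ⟨γ, hγ0⟩).mp hγ)
  obtain ⟨M, hM, hcong⟩ := hUDW k Γ hfi F hhol hΓinv hgrowth hq
  exact periodLatticeGamma1_ne_of_congruence D hopt ha h2a hM fun γ hγ ↦ hstab γ (hcong _ hγ)

/-- **(AN3₂) with the UDW input discharged from the printed Calegari–Dimitrov–Tang fact** (p2 g18's unbundling `KLine.unboundedDenominatorsWeightAlgInt_of_CDT_algInt'`).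
CONDITIONAL on the printed fact. [cite: CalegariDimitrovTang2025, Thm. 1.0.1 and Remarks 58–59] -/
theorem periodLatticeGamma1_ne_of_sqRootWitness_of_CDT_algInt [W.IsElliptic] [W.IsGloballyMinimal]
    (hCDT : Literature.NumberTheory.Automorphic.CalegariDimitrovTang2025_unboundedDenominators_algInt)
    (D : ModularParametrizationData W N) (hopt : ∀ z ∈ D.L.lattice, ∃ w ∈ periodLattice D.f, z = D.c * w)
    {a : ℂ} {m₁ m₂ : ℤ} (ha : a ∉ D.L.lattice) (h2a : 2 * a = m₁ * D.L.ω₁ + m₂ * D.L.ω₂) (k : ℤ) (F : UpperHalfPlane → ℂ)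
    (hhol : MDifferentiable 𝓘(ℂ) 𝓘(ℂ) F)
    (hinv : ∀ γ : Gamma0 N, (∀ w : ℂ, sigmaSqRoot D.L a (m₁ * D.L.η₁ + m₂ * D.L.η₂) (w + (D.c : ℂ) * cuspSymbol D.f γ) =
      sigmaSqRoot D.L a (m₁ * D.L.η₁ + m₂ * D.L.η₂) w) → F ∣[k] (γ : SL(2, ℤ)) = F)
    (hstab : ∀ γ : Gamma0 N, F ∣[k] (γ : SL(2, ℤ)) = F → ∀ w : ℂ,
      sigmaSqRoot D.L a (m₁ * D.L.η₁ + m₂ * D.L.η₂) (w + (D.c : ℂ) * cuspSymbol D.f γ) = sigmaSqRoot D.L a (m₁ * D.L.η₁ + m₂ * D.L.η₂) w)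
    (hgrowth : ∀ g : SL(2, ℤ), ∃ C A m : ℝ, ∀ τ : UpperHalfPlane, A ≤ τ.im → ‖(F ∣[k] g) τ‖ ≤ C * Real.exp (m * τ.im))
    (hq : ∃ b : ℕ → ℂ, (∀ n, IsIntegral ℤ (b n)) ∧ ∀ τ : UpperHalfPlane,
      HasSum (fun n : ℕ ↦ b n * Complex.exp (2 * Real.pi * Complex.I * (τ : ℂ) * n)) (F τ)) :
    periodLatticeGamma1 D.f ≠ periodLattice D.f :=
  periodLatticeGamma1_ne_of_sqRootWitness (KLine.unboundedDenominatorsWeightAlgInt_of_CDT_algInt' hCDT) D hopt ha h2a k F hhol hinv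
    hstab hgrowth hq

/-! ## §2 With the witness LAW (AN2₂, inline binder): `2 ∣ c` ⟹ `Λ₁(f) ≠ Λ₀(f)` -/

/-- **AN2₂ ∧ UDW ⟹ (`2 ∣ c ⟹ Λ₁(f) ≠ Λ₀(f)`)** for a lattice-optimal datum at a level `4 ∣ N` of a globally minimal curve with a rational `2`-torsion
point: an even Manin constant would force a NON-TRIVIAL Shimura `2`-quotient.  The binder `hWL` is the ℓ = 2 WITNESS LAW (AN2₂): for the data of (BI₂)
plus a half-period `a` of the `2`-torsion point (`c²℘(a) = x_s(T)`), every `2`-adically integral normalised square root of `Ξ_T` has a modular-form witness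
with `Γ₀(N)`-stabiliser `Γ_V` (shape of LEAD's ℓ = 3 (AN2)).  CONDITIONAL on `hWL` and `hUDW`; BI₂ and the germ are tree theorems.
[cite: CalegariDimitrovTang2025, Thm. 1.0.1] [cite: KurthLong2008, Prop. 18] -/
theorem periodLatticeGamma1_ne_of_two_dvd_of_sqRootWitnessLaw
    (hWL : ∀ (W : WeierstrassCurve ℚ) [W.IsElliptic] [W.IsGloballyMinimal] {N : ℕ} [NeZero N]
      (D : ModularParametrizationData W N) (a : ℕ → ℤ), (∀ n, (a n : ℂ) = cuspCoeff D.f n) → 4 ∣ N →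
      (∀ z ∈ D.L.lattice, ∃ w ∈ periodLattice D.f, z = D.c * w) →
      ∀ e : ℚ, W.twoTorsionPolynomial.toPoly.IsRoot e →
      ∀ (p : ℂ) (m₁ m₂ : ℤ), p ∉ D.L.lattice → 2 * p = m₁ * D.L.ω₁ + m₂ * D.L.ω₂ →
      ((shortRoot W D.c e : ℚ) : ℂ) = (D.c : ℂ) ^ 2 * ℘[D.L] p →
      ∀ z : ℚ⟦X⟧, IsParamGerm W D.c a z →
      ∀ h : ℚ⟦X⟧, h ^ 2 = kummerSeries W D.c e z → constantCoeff h = 1 → (∀ n : ℕ, ¬ (2 ∣ (coeff n h).den)) →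
      ∃ (k : ℤ) (F : UpperHalfPlane → ℂ), MDifferentiable 𝓘(ℂ) 𝓘(ℂ) F ∧
        (∀ γ : Gamma0 N, (∀ w : ℂ, sigmaSqRoot D.L p (m₁ * D.L.η₁ + m₂ * D.L.η₂) (w + (D.c : ℂ) * cuspSymbol D.f γ) =
          sigmaSqRoot D.L p (m₁ * D.L.η₁ + m₂ * D.L.η₂) w) → F ∣[k] (γ : SL(2, ℤ)) = F) ∧
        (∀ γ : Gamma0 N, F ∣[k] (γ : SL(2, ℤ)) = F → ∀ w : ℂ,
          sigmaSqRoot D.L p (m₁ * D.L.η₁ + m₂ * D.L.η₂) (w + (D.c : ℂ) * cuspSymbol D.f γ) =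
            sigmaSqRoot D.L p (m₁ * D.L.η₁ + m₂ * D.L.η₂) w) ∧
        (∀ g : SL(2, ℤ), ∃ C A m : ℝ, ∀ τ : UpperHalfPlane, A ≤ τ.im → ‖(F ∣[k] g) τ‖ ≤ C * Real.exp (m * τ.im)) ∧
        (∃ b : ℕ → ℂ, (∀ n, IsIntegral ℤ (b n)) ∧ ∀ τ : UpperHalfPlane,
          HasSum (fun n : ℕ ↦ b n * Complex.exp (2 * Real.pi * Complex.I * (τ : ℂ) * n)) (F τ)))
    (hUDW : ∀ k : ℤ, UnboundedDenominatorsWeightAlgInt k)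
    (W : WeierstrassCurve ℚ) [W.IsElliptic] [W.IsGloballyMinimal] {N : ℕ} [NeZero N] (D : ModularParametrizationData W N) (h4 : 4 ∣ N)
    (hopt : ∀ z ∈ D.L.lattice, ∃ w ∈ periodLattice D.f, z = D.c * w) {e : ℚ} (he : W.twoTorsionPolynomial.toPoly.IsRoot e)
    (h2c : (2 : ℤ) ∣ D.c) : periodLatticeGamma1 D.f ≠ periodLattice D.f := by
  -- the coefficients, THE germ, the half-period
  set a : ℕ → ℤ := fun n ↦ W.LFunction n with ha_def
  have ha : ∀ n, (a n : ℂ) = cuspCoeff D.f n := fun n ↦ (D.isNewformOf.2 n).symm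
  obtain ⟨z, hz⟩ := exists_isParamGerm W D.c a
  obtain ⟨p, hpΛ, h2p, h℘p⟩ := exists_halfPeriod_of_twoTorsion_root D he
  have hX : ((shortRoot W D.c e : ℚ) : ℂ) = (D.c : ℂ) ^ 2 * ℘[D.L] p := shortRoot_eq_of_weierstrassP_eq W D.c h℘p
  obtain ⟨m₁, m₂, hm⟩ := PeriodPair.mem_lattice.mp h2p
  -- BI₂: an integral normalised square root
  obtain ⟨h, hh2, hh0, hint⟩ := kummerSqRoot_twoAdicallyIntegral W D a ha h4 e he z hz h2c
  -- the witness, and §1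
  obtain ⟨k, F, hhol, hinv, hstab, hgrowth, hq⟩ := hWL W D a ha h4 hopt e he p m₁ m₂ hpΛ hm.symm hX z hz h hh2 hh0 hint
  exact periodLatticeGamma1_ne_of_sqRootWitness hUDW D hopt hpΛ hm.symm k F hhol hinv hstab hgrowth hq

/-! ## §3 C2 on the locus `{∞,0}_f ∈ Λ₀(f)` ⊇ {root number −1} for curves with a rational `2`-torsion point, modulo AN2₂ ∧ CDT ∧ F★ ∧ F♮ ∧ CES -/

/-- **C2 ON THE LOCUS `{∞,0}_f ∈ Λ₀(f)` (cusp `0 ↦ O`), reducible case, modulo AN2₂ ∧ CDT ∧ F★ ∧ F♮ ∧ CES.**  For a globally minimal `W` with a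
rational `2`-torsion point and a lattice-optimal `X₀(N)`-datum at a level `4 ∣ N` with `{∞,0}_f ∈ Λ₀(f)`: `2 ∤ c`.  (§2 gives `Λ₁ ≠ Λ₀` from `2 ∣ c`;
LEAD's `periodLatticeGamma1_eq_of_modularSymbol_zero_mem_of_print` gives `Λ₁ = Λ₀`.)  CONDITIONAL on the witness law `hWL` and four printed facts.
[cite: CalegariDimitrovTang2025, Thm. 1.0.1] [cite: Stevens1982, Thm. 1.3.1] [cite: ConradEdixhovenStein2003, §6.1.2, Thm. 1.1.3] [cite: Stevens1989, §2] -/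
theorem not_two_dvd_maninConstant_of_modularSymbol_zero_mem_of_sqRootWitnessLaw_of_print
    (hWL : ∀ (W : WeierstrassCurve ℚ) [W.IsElliptic] [W.IsGloballyMinimal] {N : ℕ} [NeZero N]
      (D : ModularParametrizationData W N) (a : ℕ → ℤ), (∀ n, (a n : ℂ) = cuspCoeff D.f n) → 4 ∣ N →
      (∀ z ∈ D.L.lattice, ∃ w ∈ periodLattice D.f, z = D.c * w) →
      ∀ e : ℚ, W.twoTorsionPolynomial.toPoly.IsRoot e →
      ∀ (p : ℂ) (m₁ m₂ : ℤ), p ∉ D.L.lattice → 2 * p = m₁ * D.L.ω₁ + m₂ * D.L.ω₂ →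
      ((shortRoot W D.c e : ℚ) : ℂ) = (D.c : ℂ) ^ 2 * ℘[D.L] p →
      ∀ z : ℚ⟦X⟧, IsParamGerm W D.c a z →
      ∀ h : ℚ⟦X⟧, h ^ 2 = kummerSeries W D.c e z → constantCoeff h = 1 → (∀ n : ℕ, ¬ (2 ∣ (coeff n h).den)) →
      ∃ (k : ℤ) (F : UpperHalfPlane → ℂ), MDifferentiable 𝓘(ℂ) 𝓘(ℂ) F ∧
        (∀ γ : Gamma0 N, (∀ w : ℂ, sigmaSqRoot D.L p (m₁ * D.L.η₁ + m₂ * D.L.η₂) (w + (D.c : ℂ) * cuspSymbol D.f γ) =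
          sigmaSqRoot D.L p (m₁ * D.L.η₁ + m₂ * D.L.η₂) w) → F ∣[k] (γ : SL(2, ℤ)) = F) ∧
        (∀ γ : Gamma0 N, F ∣[k] (γ : SL(2, ℤ)) = F → ∀ w : ℂ,
          sigmaSqRoot D.L p (m₁ * D.L.η₁ + m₂ * D.L.η₂) (w + (D.c : ℂ) * cuspSymbol D.f γ) =
            sigmaSqRoot D.L p (m₁ * D.L.η₁ + m₂ * D.L.η₂) w) ∧
        (∀ g : SL(2, ℤ), ∃ C A m : ℝ, ∀ τ : UpperHalfPlane, A ≤ τ.im → ‖(F ∣[k] g) τ‖ ≤ C * Real.exp (m * τ.im)) ∧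
        (∃ b : ℕ → ℂ, (∀ n, IsIntegral ℤ (b n)) ∧ ∀ τ : UpperHalfPlane,
          HasSum (fun n : ℕ ↦ b n * Complex.exp (2 * Real.pi * Complex.I * (τ : ℂ) * n)) (F τ)))
    (hCDT : Literature.NumberTheory.Automorphic.CalegariDimitrovTang2025_unboundedDenominators_algInt)
    (hF : optimalGamma1Parametrization_cusp_rational) (hFnat : optimalGamma1Parametrization_cuspZero_galoisConjugate)
    (hCES : exists_optimal_gamma1ParametrizationData)
    (W : WeierstrassCurve ℚ) [W.IsElliptic] [W.IsGloballyMinimal] {N : ℕ} [NeZero N] (D : ModularParametrizationData W N) (h4 : 4 ∣ N)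
    (hopt : ∀ z ∈ D.L.lattice, ∃ w ∈ periodLattice D.f, z = D.c * w) {e : ℚ} (he : W.twoTorsionPolynomial.toPoly.IsRoot e)
    (h0 : modularSymbol D.f 0 ∈ periodLattice D.f) : ¬ (2 : ℤ) ∣ D.c := fun h2c ↦
  periodLatticeGamma1_ne_of_two_dvd_of_sqRootWitnessLaw hWL (KLine.unboundedDenominatorsWeightAlgInt_of_CDT_algInt' hCDT) W D h4 hopt he h2c
    (periodLatticeGamma1_eq_of_modularSymbol_zero_mem_of_print hF hFnat hCES D hopt h0)

/-- **C2 FOR ROOT NUMBER `−1` (odd analytic rank), reducible case, at the conductor level, modulo AN2₂ ∧ CDT ∧ F★ ∧ F♮ ∧ CES.**  For a globally minimal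
`W` with `4 ∣ N_W`, `w(W) = −1`, a rational `2`-torsion point and a lattice-optimal `X₀(N_W)`-datum `D`: `2 ∤ c`.  CONDITIONAL on the witness law and four
printed facts. [cite: CalegariDimitrovTang2025, Thm. 1.0.1] [cite: AtkinLehner1970, Thm. 3] [cite: Stevens1989, §2] [cite: ConradEdixhovenStein2003, Thm. 1.1.3] -/
theorem not_two_dvd_maninConstant_of_rootNumber_eq_neg_one_of_sqRootWitnessLaw_of_print
    (hWL : ∀ (W : WeierstrassCurve ℚ) [W.IsElliptic] [W.IsGloballyMinimal] {N : ℕ} [NeZero N]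
      (D : ModularParametrizationData W N) (a : ℕ → ℤ), (∀ n, (a n : ℂ) = cuspCoeff D.f n) → 4 ∣ N →
      (∀ z ∈ D.L.lattice, ∃ w ∈ periodLattice D.f, z = D.c * w) →
      ∀ e : ℚ, W.twoTorsionPolynomial.toPoly.IsRoot e →
      ∀ (p : ℂ) (m₁ m₂ : ℤ), p ∉ D.L.lattice → 2 * p = m₁ * D.L.ω₁ + m₂ * D.L.ω₂ →
      ((shortRoot W D.c e : ℚ) : ℂ) = (D.c : ℂ) ^ 2 * ℘[D.L] p →
      ∀ z : ℚ⟦X⟧, IsParamGerm W D.c a z →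
      ∀ h : ℚ⟦X⟧, h ^ 2 = kummerSeries W D.c e z → constantCoeff h = 1 → (∀ n : ℕ, ¬ (2 ∣ (coeff n h).den)) →
      ∃ (k : ℤ) (F : UpperHalfPlane → ℂ), MDifferentiable 𝓘(ℂ) 𝓘(ℂ) F ∧
        (∀ γ : Gamma0 N, (∀ w : ℂ, sigmaSqRoot D.L p (m₁ * D.L.η₁ + m₂ * D.L.η₂) (w + (D.c : ℂ) * cuspSymbol D.f γ) =
          sigmaSqRoot D.L p (m₁ * D.L.η₁ + m₂ * D.L.η₂) w) → F ∣[k] (γ : SL(2, ℤ)) = F) ∧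
        (∀ γ : Gamma0 N, F ∣[k] (γ : SL(2, ℤ)) = F → ∀ w : ℂ,
          sigmaSqRoot D.L p (m₁ * D.L.η₁ + m₂ * D.L.η₂) (w + (D.c : ℂ) * cuspSymbol D.f γ) =
            sigmaSqRoot D.L p (m₁ * D.L.η₁ + m₂ * D.L.η₂) w) ∧
        (∀ g : SL(2, ℤ), ∃ C A m : ℝ, ∀ τ : UpperHalfPlane, A ≤ τ.im → ‖(F ∣[k] g) τ‖ ≤ C * Real.exp (m * τ.im)) ∧
        (∃ b : ℕ → ℂ, (∀ n, IsIntegral ℤ (b n)) ∧ ∀ τ : UpperHalfPlane,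
          HasSum (fun n : ℕ ↦ b n * Complex.exp (2 * Real.pi * Complex.I * (τ : ℂ) * n)) (F τ)))
    (hCDT : Literature.NumberTheory.Automorphic.CalegariDimitrovTang2025_unboundedDenominators_algInt)
    (hF : optimalGamma1Parametrization_cusp_rational) (hFnat : optimalGamma1Parametrization_cuspZero_galoisConjugate)
    (hCES : exists_optimal_gamma1ParametrizationData)
    (W : WeierstrassCurve ℚ) [W.IsElliptic] [W.IsGloballyMinimal] [NeZero (W.conductorNorm ℤ)] (h4 : 4 ∣ W.conductorNorm ℤ)
    (hw : W.rootNumber = -1) (D : ModularParametrizationData W (W.conductorNorm ℤ))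
    (hopt : ∀ z ∈ D.L.lattice, ∃ w ∈ periodLattice D.f, z = D.c * w) {e : ℚ} (he : W.twoTorsionPolynomial.toPoly.IsRoot e) :
    ¬ (2 : ℤ) ∣ D.c := fun h2c ↦
  periodLatticeGamma1_ne_of_two_dvd_of_sqRootWitnessLaw hWL (KLine.unboundedDenominatorsWeightAlgInt_of_CDT_algInt' hCDT) W D h4 hopt he h2c
    (periodLatticeGamma1_eq_of_rootNumber_eq_neg_one_of_print hF hFnat hCES D hopt hw)

end Summit.BirchSwinnertonDyer.BirchSwinnertonDyer.Theorems.ManinLocalTwoThree.UDCTwo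

end
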